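import Summits.BirchSwinnertonDyer.BirchSwinnertonDyer.Theorems.GenusKolyvaginAtTwoK4NegPhantomDeepTwistShaOverK
import HarnessLib

/-!
# Route `GenusKolyvaginAtTwo`, crux K₄⁻ `K4Neg` (stmt-BirchSwinnertonDyer-31526), the (β)/𝒫-frames — PHANTOM PERSISTENCE UNDER DEEP TWISTING, part 5:
# every SQUARE-FREE deep level `n` (any number of deep primes), and the `loc₂ ξ_E = 0` sub-cell (no congruence on `D_n` needed)

Seat `bsd-line-gk2-p3` g35 (PROVER seat 3/3, cell `bsd-f1-sign2`), sequel of parts 1–4 (p792861, p793066, p793464, p794124), `--supports stmt-BirchSwinnertonDyer-31526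
--as helper`.  THEOREMS ONLY (no definition, no named fact, no `sorry`); standard axioms; UNCONDITIONAL.  **BSD is NOT proved by this file; K4Neg is neither
proved nor refuted by it; nothing is closed.**

WHY.  K4Neg's conclusion offers a witness `P(n)` at a SQUARE-FREE product `n = ℓ₁⋯ℓ_r` of deep primes, not only at a prime; the genus ledger of the memo
(`K4NEG-BETA-GENUS-VERDICT-gk2p3-g35.md`, (★): `k_n = r + ½·ord₂ #Ш(E^{(D_n)}/K)[2^∞]`, `D_n = ∏(−ℓ_i)`) needs `Ш(E^{(D_n)}/K)[2] ≠ 0` at every such level, and on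
the `a₂ = 0` supersingular sub-cell (`loc₂ ξ_E = 0`, T_A) it needs it WITHOUT the congruence `D_n ≡ 1 (8)`.  Part 4 §4 packaged the prime level with `ℓ ≡ 7 (8)`;
this file packages the general level with the `2`-adic disjunction «`D ≡ 1 (8)` ∨ `loc₂ ξ_E = 0`» of part 1.

WHAT.
* §1 `two_le_natCard_selmerGroup_frameTwist_of_phantom_selmer_of_kolyvaginPrimes'` — part 2's 𝒫-partner theorem with the `2`-adic hypothesis relaxed to
  «`D ≡ 1 (8)` ∨ `loc₂ ξ = 0`» (then `−ℓ₀D` needs no congruence either).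
* §2 ★★★ `two_le_natCard_sha_baseChange_deepTwist_squarefree_of_phantom_selmer` — phantom cell, 𝒫-frame (`4 ∣ a_{ℓ₀}`, `2` split), `D ≠ 0` with «`D ≡ 1 (8)` ∨
  `loc₂ ξ = 0`» whose odd prime factors are K4Neg-deep and `≠ ℓ₀` (e.g. `D = D_n` for any admissible square-free `n` with an even number of `ℓ_i ≡ 3 (8)`, or any `n` at
  all when `loc₂ ξ = 0`); `X`, `X'` any elliptic models of `W^{(D)}`, `W^{(−ℓ₀D)}`; IF `rank X(K) = 1` and one of `X`, `X'` has Mordell–Weil rank `0` with `Ш[2^∞]` finite,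
  THEN `#(Ш(X/K) ⊓ H¹(K,X)[2]) ≥ 2` — the input `s_n ≥ 1` of (★) at EVERY admissible level, hence (memo) `k_n ≥ r + 1` and `P(n) ∈ 2E(K[n])`.

References: [GrossLMS1991] §3, §5 (5.1); [SilvermanAEC2009] Thm. X.4.2; [Cassels1962ArithmeticIV] §1; [MazurRubin2010] Lemma 3.2; [LawsonWuthrich2016] §7.1.
-/

set_option linter.dupNamespace false -- tree convention: `Summit.BirchSwinnertonDyer.BirchSwinnertonDyer.Theorems` (summit = sub-problem)
set_option autoImplicit false

noncomputable section

open scoped Classical NumberField AddSubgroup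

namespace Summit.BirchSwinnertonDyer.BirchSwinnertonDyer.Theorems.GenusExact.PhantomDescentBit.DeepTwist

open WeierstrassCurve Field NumberField IsDedekindDomain
open Literature.NumberTheory.EllipticCurves Literature.NumberTheory.GaloisRepresentations
open Rat.HeightOneSpectrum (primesEquiv)

variable (W : WeierstrassCurve ℚ) [W.IsElliptic] [W.IsGloballyMinimal] [NeZero (W.conductorNorm ℤ)]

/-! ## §1 The 𝒫-partner with the relaxed `2`-adic hypothesis -/

/-- **Part 2's 𝒫-partner theorem with «`D ≡ 1 (8)` ∨ `loc₂ ξ = 0`».**  Phantom cell; prime Heegner frame `K = ℚ(√−ℓ₀)` (`d_K` odd, Heegner, `2` split) which is 𝒫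
(`4 ∣ a_{ℓ₀}`); `D ≠ 0` whose odd prime factors are K4Neg-deep and `≠ ℓ₀`; at `2`: `D ≡ 1 (8)` (then `−ℓ₀D ≡ 1 (8)`) OR `ξ` is killed at the place over `2`.  Then every
elliptic model of `W^{(−ℓ₀·D)}` has `#Sel₂ ≥ 2`. [cite: GrossLMS1991, §9 Prop. 9.6] [cite: MazurRubin2010, Lemma 2.10, Lemma 3.2] [cite: LawsonWuthrich2016, §7.1] -/
theorem two_le_natCard_selmerGroup_frameTwist_of_phantom_selmer_of_kolyvaginPrimes' {K : Type} [Field K] [NumberField K]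
    (hT : Odd W.tamagawaProduct)
    (hoff : ¬ ∃ v : HeightOneSpectrum (𝓞 ℚ), ((2 : ℕ) : 𝓞 ℚ) ∉ v.asIdeal ∧ ((W.conductorNorm ℤ : ℕ) : 𝓞 ℚ) ∈ v.asIdeal ∧
      W.HasMultiplicativeReductionAt v)
    (hΔ : W.Δ < 0) (hsurj : W.HasSurjectiveModNGaloisRep 2) (hsurj4 : W.HasSurjectiveModNGaloisRep 4)
    {ξ : galH1Torsion W (2 : ℤ)} (hξ0 : ξ ≠ 0) (hξ4 : ∀ h ∈ torsionFixing W (4 : ℤ), h1Eval W (2 : ℤ) ξ h = 0)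
    (hξS : ξ ∈ W.selmerGroup 2)
    (hK : IsImaginaryQuadratic K) (hodd : Odd (discr K)) (hH : SatisfiesHeegnerHypothesis (W.conductorNorm ℤ) K)
    (h2K : ((Ideal.span {(2 : ℤ)}).primesOver (𝓞 K)).ncard = 2)
    {ℓ₀ : ℕ} (hℓ₀ : ℓ₀.Prime) (hd : discr K = -(ℓ₀ : ℤ)) (hP : (4 : ℤ) ∣ W.frobeniusTrace ℓ₀)
    {D : ℤ} (hD : D ≠ 0)
    (h2 : (8 : ℤ) ∣ D - 1 ∨ ∀ v : HeightOneSpectrum (𝓞 ℚ), ((2 : ℕ) : 𝓞 ℚ) ∈ v.asIdeal →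
      ξ ∈ W.torsionLocalKer (v.adicCompletion ℚ) (2 : ℤ))
    (hdeep : ∀ (ℓ : ℕ), ℓ.Prime → ℓ ≠ 2 → (ℓ : ℤ) ∣ D →
      ℓ ≠ ℓ₀ ∧ ¬ ℓ ∣ W.conductorNorm ℤ ∧ FrobEqFrobInfty W K 2 ℓ ∧ 2 ≤ Zhang2014.kolyvaginIndex W 2 ℓ)
    (Wd' : WeierstrassCurve ℚ) [Wd'.IsElliptic] {C : VariableChange ℚ}
    (hWd' : C • W.quadraticTwist ((-(ℓ₀ : ℤ) * D : ℤ) : ℚ) = Wd') :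
    2 ≤ Nat.card (Wd'.selmerGroup 2) := by
  haveI : Fact ℓ₀.Prime := ⟨hℓ₀⟩
  obtain ⟨hℓ₀2, hℓ₀N, -⟩ := GenusKolyTwin.prime_discr_facts W hK hodd hH hℓ₀ hd
  have hD0 : -(ℓ₀ : ℤ) * D ≠ 0 := mul_ne_zero (neg_ne_zero.mpr (by exact_mod_cast hℓ₀.ne_zero)) hD
  -- the place over `2`: `−ℓ₀D ≡ 1 (8)` or `ξ` killed there
  have h2' : ∀ v : HeightOneSpectrum (𝓞 ℚ), ((2 : ℕ) : 𝓞 ℚ) ∈ v.asIdeal →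
      (∃ s : v.adicCompletion ℚ, s ^ 2 = algebraMap ℚ (v.adicCompletion ℚ) ((-(ℓ₀ : ℤ) * D : ℤ) : ℚ)) ∨
        ξ ∈ W.torsionLocalKer (v.adicCompletion ℚ) ((2 : ℕ) : ℤ) := by
    intro v h2v
    rcases h2 with h8 | hloc
    · have hK8 : discr K % 8 = 1 := (Literature.NumberTheory.QuadraticFields.Quadratic.ncard_primesOver_two_eq_two_iff hK.1).mp h2K
      have hℓ8 : (8 : ℤ) ∣ -(ℓ₀ : ℤ) - 1 := by
        rw [← hd]
        omega
      have h8' : (8 : ℤ) ∣ -(ℓ₀ : ℤ) * D - 1 := by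
        have : -(ℓ₀ : ℤ) * D - 1 = -(ℓ₀ : ℤ) * (D - 1) + (-(ℓ₀ : ℤ) - 1) := by ring
        rw [this]
        exact dvd_add (dvd_mul_of_dvd_right h8 _) hℓ8
      exact Or.inl (exists_sq_eq_adicCompletion_two_of_eight_dvd h8' v h2v)
    · exact Or.inr (hloc v h2v)
  refine two_le_natCard_selmerGroup_twist_of_selmer_of_offCut W hT hoff hΔ (ξ := ξ) hξ0 hξS hD0 Wd' hWd' h2' ?_
  intro ℓ _ hℓ2 hℓD
  have hℓ : ℓ.Prime := Fact.out
  by_cases hℓℓ₀ : ℓ = ℓ₀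
  · subst hℓℓ₀
    exact ⟨hℓ₀N, mem_torsionLocalKer_padic_framePrime_of_four_dvd W hΔ hsurj hsurj4 hξ0 hξ4 hK hodd hH hd hP⟩
  · have hℓD' : (ℓ : ℤ) ∣ D := by
      rcases (Nat.prime_iff_prime_int.mp hℓ).dvd_or_dvd hℓD with h | h
      · exfalso
        have h' : (ℓ : ℤ) ∣ (ℓ₀ : ℤ) := (dvd_neg).mp h
        have : ℓ ∣ ℓ₀ := by exact_mod_cast h'
        exact hℓℓ₀ ((Nat.prime_dvd_prime_iff_eq hℓ hℓ₀).mp this)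
      · exact h
    obtain ⟨-, hℓN, hF, hk⟩ := hdeep ℓ hℓ hℓ2 hℓD'
    obtain ⟨h4, v, 𝔓, γ, c₀, hℓv, h𝔓, hγ, hc₀, hγc⟩ := deep_datum_of_frobEqFrobInfty_of_le_kolyvaginIndex W hF hk
    exact ⟨hℓN, mem_torsionLocalKer_padic_of_deep_datum W hΔ hsurj hsurj4 hξ0 hξ4 hℓ2 hℓN h4 hℓv h𝔓 hγ hc₀ hγc⟩

/-! ## §2 ★★★ The ledger input at every square-free deep level -/

/-- ★★★ **ON A 𝒫-FRAME, AT EVERY SQUARE-FREE DEEP LEVEL, `Ш(E^{(D_n)}/K)[2] ≠ 0` — granted the GZK shape of «`L′(E/K, χ_n, 1) ≠ 0`».**  Phantom cell (`W/ℚ`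
globally minimal, `C(W)` odd, off the cut, `Δ < 0`, `ρ̄_{W,2}`, `ρ_{W,4}` onto, the Lawson–Wuthrich class `ξ` SELMER); prime Heegner frame `K = ℚ(√−ℓ₀)` (`d_K = −ℓ₀` odd,
Heegner for `N_W`, `2` split) which is 𝒫 (`4 ∣ a_{ℓ₀}(W)`); `D ≠ 0` an integer with «`D ≡ 1 (8)` ∨ `loc₂ ξ = 0`» all of whose odd prime factors `ℓ` are K4Neg-deep (`ℓ ∤ N_W`,
`FrobEqFrobInfty W K 2 ℓ`, `2 ≤ kolyvaginIndex W 2 ℓ`) and `≠ ℓ₀` — e.g. `D = D_n = ∏(−ℓ_i)` for a square-free `n` as in K4Neg's conclusion; `X`, `X'` any elliptic models of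
`W^{(D)}`, `W^{(−ℓ₀D)}` (the genus pair at level `n`; `X' ≅ X` over `K`).  IF `rank X(K) = 1` and one of `X`, `X'` has Mordell–Weil rank `0` with `Ш[2^∞]` finite, THEN
`#(Ш(X/K) ⊓ H¹(K,X)[2]) ≥ 2`.  Chain: part 1 §3 and §1 above (`#Sel₂ ≥ 2` for both members), part 4 §3 (Cassels–Tate: the rank-`0` member has `#Sel₂ ≥ 4`), part 4 §1–§2
(Gross's injections into `Sel₂(X/K)` and the descent count over `K`).  With the memo's (★) this is `k_n ≥ ω(n) + 1`, i.e. `P(n) ∈ 2E(K[n])`.  BSD is NOT proved by this;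
K4Neg is neither proved nor refuted here.
[cite: GrossLMS1991, §3 (3.1)–(3.3), §5 (5.1), §9 Prop. 9.6] [cite: SilvermanAEC2009, Thm. X.4.2] [cite: Cassels1962ArithmeticIV, §1] [cite: MazurRubin2010, Lemma 3.2]
[cite: LawsonWuthrich2016, §7.1] -/
theorem two_le_natCard_sha_baseChange_deepTwist_squarefree_of_phantom_selmer {K : Type} [Field K] [NumberField K]
    (hT : Odd W.tamagawaProduct)
    (hoff : ¬ ∃ v : HeightOneSpectrum (𝓞 ℚ), ((2 : ℕ) : 𝓞 ℚ) ∉ v.asIdeal ∧ ((W.conductorNorm ℤ : ℕ) : 𝓞 ℚ) ∈ v.asIdeal ∧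
      W.HasMultiplicativeReductionAt v)
    (hΔ : W.Δ < 0) (hsurj : W.HasSurjectiveModNGaloisRep 2) (hsurj4 : W.HasSurjectiveModNGaloisRep 4)
    {ξ : galH1Torsion W (2 : ℤ)} (hξ0 : ξ ≠ 0) (hξ4 : ∀ h ∈ torsionFixing W (4 : ℤ), h1Eval W (2 : ℤ) ξ h = 0)
    (hξS : ξ ∈ W.selmerGroup 2)
    (hK : IsImaginaryQuadratic K) (hodd : Odd (discr K)) (hH : SatisfiesHeegnerHypothesis (W.conductorNorm ℤ) K)
    (h2K : ((Ideal.span {(2 : ℤ)}).primesOver (𝓞 K)).ncard = 2)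
    {ℓ₀ : ℕ} (hℓ₀ : ℓ₀.Prime) (hd : discr K = -(ℓ₀ : ℤ)) (hP : (4 : ℤ) ∣ W.frobeniusTrace ℓ₀)
    {D : ℤ} (hD : D ≠ 0)
    (h2 : (8 : ℤ) ∣ D - 1 ∨ ∀ v : HeightOneSpectrum (𝓞 ℚ), ((2 : ℕ) : 𝓞 ℚ) ∈ v.asIdeal →
      ξ ∈ W.torsionLocalKer (v.adicCompletion ℚ) (2 : ℤ))
    (hdeep : ∀ (ℓ : ℕ), ℓ.Prime → ℓ ≠ 2 → (ℓ : ℤ) ∣ D →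
      ℓ ≠ ℓ₀ ∧ ¬ ℓ ∣ W.conductorNorm ℤ ∧ FrobEqFrobInfty W K 2 ℓ ∧ 2 ≤ Zhang2014.kolyvaginIndex W 2 ℓ)
    (X : WeierstrassCurve ℚ) [X.IsElliptic] {CX : VariableChange ℚ} (hX : CX • W.quadraticTwist (D : ℚ) = X)
    (X' : WeierstrassCurve ℚ) [X'.IsElliptic] {CX' : VariableChange ℚ} (hX' : CX' • W.quadraticTwist ((-(ℓ₀ : ℤ) * D : ℤ) : ℚ) = X')
    (hrK : (X.baseChange K).mordellWeilRank = 1)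
    (hrank : (X.mordellWeilRank = 0 ∧ Finite (AddCommGroup.primaryComponent X.sha 2)) ∨
      (X'.mordellWeilRank = 0 ∧ Finite (AddCommGroup.primaryComponent X'.sha 2))) :
    2 ≤ Nat.card ((X.baseChange K).sha ⊓ AddSubgroup.torsionBy (X.baseChange K).galH1 2 : AddSubgroup (X.baseChange K).galH1) := by
  have hD0 : (D : ℚ) ≠ 0 := by exact_mod_cast hD
  have hdeep₀ : ∀ (ℓ : ℕ), ℓ.Prime → ℓ ≠ 2 → (ℓ : ℤ) ∣ D →
      ¬ ℓ ∣ W.conductorNorm ℤ ∧ FrobEqFrobInfty W K 2 ℓ ∧ 2 ≤ Zhang2014.kolyvaginIndex W 2 ℓ :=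
    fun ℓ hℓ hℓ2 hℓD ↦ (hdeep ℓ hℓ hℓ2 hℓD).2
  -- `ρ̄_{X,2}` onto
  have hsX : X.HasSurjectiveModNGaloisRep 2 := hasSurjectiveModNGaloisRep_two_of_smul_quadraticTwist W hsurj hD0 X hX
  -- `X'` is a model of `X^{(d_K)}`
  have hX'q : CX' • W.quadraticTwist ((NumberField.discr K : ℚ) * (D : ℚ)) = X' := by
    rw [hd]; push_cast; push_cast at hX'; exact hX'
  obtain ⟨C'', hC''⟩ := exists_smul_quadraticTwist_eq_of_models W X X' hX hX'q
  -- both members carry `ξ`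
  have hSX : 2 ≤ Nat.card (X.selmerGroup 2) :=
    two_le_natCard_selmerGroup_twist_of_phantom_selmer_of_kolyvaginPrimes W hT hoff hΔ hsurj hsurj4 hξ0 hξ4 hξS hD X hX h2 hdeep₀
  have hSX' : 2 ≤ Nat.card (X'.selmerGroup 2) :=
    two_le_natCard_selmerGroup_frameTwist_of_phantom_selmer_of_kolyvaginPrimes' W hT hoff hΔ hsurj hsurj4 hξ0 hξ4 hξS hK hodd hH h2K
      hℓ₀ hd hP hD h2 hdeep X' hX'
  rcases hrank with ⟨hr0, hfin⟩ | ⟨hr0, hfin⟩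
  · haveI := hfin
    have h4 : 4 ≤ Nat.card (X.selmerGroup 2) := four_le_natCard_selmerGroup_of_rank_zero X hsX hr0 hSX
    exact two_le_natCard_sha_baseChange_of_four_le_natCard_selmerGroup_twist X K hK hsX hrK X (C := 1)
      (Or.inl (one_smul _ X)) h4
  · haveI := hfin
    have hdK0 : (NumberField.discr K : ℚ) ≠ 0 := by exact_mod_cast NumberField.discr_ne_zero K
    have hsX' : X'.HasSurjectiveModNGaloisRep 2 := hasSurjectiveModNGaloisRep_two_of_smul_quadraticTwist X hsX hdK0 X' hC''
    have h4 : 4 ≤ Nat.card (X'.selmerGroup 2) := four_le_natCard_selmerGroup_of_rank_zero X' hsX' hr0 hSX'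
    exact two_le_natCard_sha_baseChange_of_four_le_natCard_selmerGroup_twist X K hK hsX hrK X' (Or.inr hC'') h4

end Summit.BirchSwinnertonDyer.BirchSwinnertonDyer.Theorems.GenusExact.PhantomDescentBit.DeepTwist

end
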